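import Summits.CriticalPhenomena.PercolationContinuityZ3.Theses.PercMinContact
import Summits.CriticalPhenomena.PercolationContinuityZ3.Theorems.PercMinContactTwoArmGlue
import Literature.Probability.Percolation.TwoGhostInequalityProofs
import Literature.Probability.Percolation.SharpnessDCTProofs
import HarnessLib

/-!
# Birth skeleton (BC3) for crux `MinContactExponent` — item stmt-CriticalPhenomena-11498,
# route `PercMinContact` (rank 3), sub-problem `PercolationContinuityZ3`

Crux BY NAME: `Summit.CriticalPhenomena.PercolationContinuityZ3.Theses.PercMinContact.MinContactExponent`
`= ∃ C a₀, a₀ < 1 ∧ ∀ u ∈ [0, p_c(ℤ³)), m(u) ≤ ofReal (C (p_c − u)^{−a₀})`, where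
`m(u) = E_u[Σ_{y ∼ 0} 1{0 ↮ y} min(|C(0)|, |C(y)|)]` is the MIN-CONTACT FUNCTION of bond percolation on `ℤ³`
at level `projIcc u` (six neighbours of the origin, cluster sizes in `ℕ∞`, expectation in `[0, ∞]`).
Scaling truth `m(p_c − s) ≍ s^{β−1}`, `1 − β ≈ 0.58 < 1`; refuter MC on the crux item measured `a₀ ≈ 0.62`.

## The cut: SQUARE-ROOT SPLIT AT THE TWO-GHOST EXPONENT (two-cluster ↦ one-cluster at exponent 1/2)

Layer cake (LANDED, `Theorems.lintegral_sum_indicator_min_le`, from TwoArmGlue p-item 11503):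
`m(u) ≤ Σ_{k ≥ 0} T_{k+1}(u)`, `T_n(u) := Σ_{y ∼ 0} P_u(|C(0)| ≥ n, |C(y)| ≥ n, 0 ↮ y)` (the adjacent-distinct
volume two-arm function). Hutchcroft's two-ghost inequality (Ann. Probab. 2020, Cor. 1.7; PROVED in the tree,
`Hutchcroft2020_twoGhost_corollary_holds`) bounds `T_n(u) ≤ C n^{-1/2}` UNIFORMLY in `u` — summed against the
true volume window this only gives `a₀ ≈ 1.1 > 1` (the crux's recorded why-it-might-fail). The line factors the
missing gain through ONE intermediate currency, the HALF MOMENT `E_u √|C(0)| ≍ Σ_n n^{-1/2} P_u(|C(0)| ≥ n)`: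

* `stub_condTwoGhost` — **CONDITIONAL TWO-GHOST** (two-cluster → one-cluster, the ENGINE): uniformly in
  `u ∈ [0, p_c)` and `n ≥ 1`, `T_n(u) ≤ C n^{-1/2} · P_u(|C(0)| ≥ n)`: Hutchcroft's `n^{-1/2}` survives
  conditioning on `{|C(0)| ≥ n}`. Scaling: `T_n(p_c) ≍ n^{-λ₂}`, `λ₂ = (d − 1/ν)/d_f ≈ 0.737` (pivotal /
  four-arm hyperscaling; `= 60/91` exactly in `d = 2`), against `n^{-1/2 − 1/δ} = n^{-0.69}`: predicted TRUE iff
  `σ = 1/(ν d_f) ≤ 1/2` — `σ(3) = 0.452` (true also in `d = 2`, `σ = 36/91`; borderline in mean field, `σ = 1/2`).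
  Beyond the window (`n ≫ s^{-Δ}`) BK + sharpness already give it. Open; no conditional form is in print.
* `stub_halfMomentExponent` — **HALF-MOMENT EXPONENT `γ_{1/2} < 1`** (one-cluster, subcritical):
  `Σ_n n^{-1/2} P_u(|C(0)| ≥ n) ≤ C (p_c − u)^{-a₀}` with `a₀ < 1` on `[0, p_c)`, i.e. `E_u √|C(0)|` diverges slower
  than `(p_c − u)^{-1}`. Scaling: `γ_{1/2} = γ − Δ/2 ≈ 1.79 − 1.105 = 0.685 < 1` (margin 0.31); mean field `0`;
  FAILS in `d = 2` (`81/72`), so the stub is dimension-sensitive in the right direction. A statement about the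
  one-cluster size law only — the currency of sharpness / differential-inequality / OSSS technology
  (rigorous today: `γ ≥ 1`, Aizenman–Newman; no polynomial UPPER bound on any divergent moment is known in `d = 3`).

Feasible split exponents form the window `q ∈ ((γ−1)σ, 1 − σ) = (0.359, 0.548)`, non-empty iff `β > 0`; `q = 1/2`
is chosen because it is the printed two-ghost exponent (stub A = "two-ghost survives conditioning"). The
composition works verbatim for any `q`; if stub A proves delicate at `1/2`, re-register at `q = 9/20`.

Composition `MinContactExponent_of` is a real proof (layer cake ▸ termwise stub A ▸ pull the constant ▸ stub B ▸
`ofReal` algebra), concluding the crux BY NAME with `C = max C₁ 0 · C₂` and stub B's `a₀`.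

## Costume / shredding check
Neither stub is the crux or the summit in disguise: stub A is a RATIO statement (trivially true at `u = 0`,
silent about divergence rates), stub B never mentions two clusters or `m`; the crux implies neither. `m(u)` and
`E_u√|C|` are NOT equivalent functionals (unlike `E_u[|C(0)| Σ_y 1{|C(y)| ≥ |C(0)|, 0 ↮ y}] ∈ [m/2, m]`, which was
rejected as a costume). BC3 probes `stub → MinContactExponent`, `stub → PercolationContinuityZ3` by
`first | exact? | simpa | aesop` fail 4/4 (planner folder `bc/MinContactExponent_probes.lean`).

## Disproof used
No `Cruxes/MinContactExponent/Disproof.lean` and no landed `Theorems/MinContactExponent/Negative/*` exist at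
registration (2026-08-17); `ledger negatives --problem CriticalPhenomena` (11 items) has nothing on moments,
two-arm events or the min-contact function. Refuter evidence on the item honoured: `Level0.lean` (m = 6 at level 0:
both stubs are stated on `0 ≤ u` only, as the crux) and `PercMinContactNumerics.md` (a₀ ≈ 0.62 measured).

## Far-from-critical regime (inside each stub, classical)
For `u ≤ p_c − s₀`: stub A there follows from BK + subcritical exponential volume decay (`DCT16.perc_sharpness_holds`,
PROVED: Menshikov / Aizenman–Barsky / Duminil-Copin–Tassion), stub B from monotonicity of `u ↦ P_u(|C| ≥ n)`
(monotone coupling `configOfLabels`, in the tree) and finiteness at one subcritical level. The content of both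
stubs is the window `p_c − s₀ < u < p_c`.
-/

noncomputable section

namespace Summit.CriticalPhenomena.PercolationContinuityZ3.Cruxes.MinContactExponent.Birth

open MeasureTheory
open scoped ENNReal BigOperators
open Literature.Probability.Percolation Literature.Probability.LatticeModels
open Summit.CriticalPhenomena.PercolationContinuityZ3.Theses.PercMinContact

/-! ## Objects (abbreviations used by the composition; the stub signatures below are self-contained) -/

/-- The min-contact function `m(u)` at real level `u` (the crux's left-hand side, verbatim). -/
def minContact (u : ℝ) : ℝ≥0∞ :=
  ∫⁻ ω, ∑ y ∈ (zdGraph 3).neighborFinset (0 : Site 3),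
      (openConn (0 : Site 3) y)ᶜ.indicator
        (fun ω => min ((openCluster ω 0).encard : ℝ≥0∞) ((openCluster ω y).encard : ℝ≥0∞)) ω
    ∂(bondPercolation (zdGraph 3) (Set.projIcc (0 : ℝ) 1 zero_le_one u))

/-- The adjacent-distinct volume two-arm function `T_{k+1}(u) = Σ_{y ∼ 0} P_u(|C(0)| ≥ k+1, |C(y)| ≥ k+1, 0 ↮ y)`. -/
def twoArm (u : ℝ) (k : ℕ) : ℝ≥0∞ :=
  ∑ y ∈ (zdGraph 3).neighborFinset (0 : Site 3),
    bondPercolation (zdGraph 3) (Set.projIcc (0 : ℝ) 1 zero_le_one u)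
      {ω | ((k + 1 : ℕ) : ℕ∞) ≤ (openCluster ω (0 : Site 3)).encard ∧
        ((k + 1 : ℕ) : ℕ∞) ≤ (openCluster ω y).encard ∧ ¬ (openGraph ω).Reachable 0 y}

/-- The square-root-weighted one-arm term `(k+1)^{-1/2} · P_u(|C(0)| ≥ k+1)` (summing over `k` gives
`≍ E_u √|C(0)|`). -/
def halfArm (u : ℝ) (k : ℕ) : ℝ≥0∞ :=
  ENNReal.ofReal (((k + 1 : ℕ) : ℝ) ^ (-(1 / 2 : ℝ))) *
    bondPercolation (zdGraph 3) (Set.projIcc (0 : ℝ) 1 zero_le_one u) (clusterSizeGe (0 : Site 3) (k + 1))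

/-! ## The stubs (signatures self-contained over `Literature.Probability.Percolation`) -/

/-- **Stub A — CONDITIONAL TWO-GHOST at exponent 1/2 (the engine; open; size XL).** There is `C` such that for
every level `0 ≤ u < p_c(ℤ³)` and every `n = k+1 ≥ 1`,
`Σ_{y ∼ 0} P_u(|C(0)| ≥ n, |C(y)| ≥ n, 0 ↮ y) ≤ C · n^{-1/2} · P_u(|C(0)| ≥ n)`.
Hutchcroft's two-ghost inequality (PROVED in the tree, `Hutchcroft2020_twoGhost_corollary_holds`) is the same
bound WITHOUT the factor `P_u(|C(0)| ≥ n)`; the stub asks that the `n^{-1/2}` survive conditioning on the volume of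
one of the two clusters. Why plausibly true: scaling `λ₂ = (d − 1/ν)/d_f ≈ 0.737 ≥ 1/2 + 1/δ ≈ 0.69` (needs
`σ ≤ 1/2`; `σ(3) = 0.452`); holds in `d = 2` (`60/91 ≥ 1/2 + 5/91`); beyond the correlation window BK + sharpness.
Why it might fail: a constant-free conditional form could lose a logarithm in the window; `σ ≤ 1/2` is a numerical,
not a rigorous, input. Leans on: ghost-field / OSSS exploration martingale of `TwoGhostInequalityProofs`
(`TwoGhost.lintegral_sq_hp_le`, mass transport `TwoGhost.edge_vertex_mass_transport`), `DCT16.perc_sharpness_holds`.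
[cite: Hutchcroft2020Locality, Corollary 1.7 (the unconditional bound, constant 66·deg)] -/
theorem stub_condTwoGhost :
    ∃ C : ℝ, ∀ u : ℝ, 0 ≤ u → u < criticalProb (zdGraph 3) (0 : Site 3) → ∀ k : ℕ,
      ∑ y ∈ (zdGraph 3).neighborFinset (0 : Site 3),
          bondPercolation (zdGraph 3) (Set.projIcc (0 : ℝ) 1 zero_le_one u)
            {ω | ((k + 1 : ℕ) : ℕ∞) ≤ (openCluster ω (0 : Site 3)).encard ∧
              ((k + 1 : ℕ) : ℕ∞) ≤ (openCluster ω y).encard ∧ ¬ (openGraph ω).Reachable 0 y}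
        ≤ ENNReal.ofReal C *
            (ENNReal.ofReal (((k + 1 : ℕ) : ℝ) ^ (-(1 / 2 : ℝ))) *
              bondPercolation (zdGraph 3) (Set.projIcc (0 : ℝ) 1 zero_le_one u)
                (clusterSizeGe (0 : Site 3) (k + 1))) := by
  sorry

/-- **Stub B — HALF-MOMENT EXPONENT `γ_{1/2} < 1` (one-cluster, subcritical; open; size L–XL).** There are `C`
and `a₀ < 1` such that for every level `0 ≤ u < p_c(ℤ³)`,
`Σ_{n ≥ 1} n^{-1/2} P_u(|C(0)| ≥ n) ≤ C (p_c − u)^{-a₀}` — equivalently (up to a factor 2) `E_u √|C(0)| ≤ C (p_c−u)^{-a₀}`.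
Why plausibly true: scaling `γ_{1/2} = γ − Δ/2 ≈ 0.685` (`γ ≈ 1.79`, `Δ = β + γ ≈ 2.21`), margin `0.31`; mean
field `0`. Why it might fail: it is an UPPER bound on a divergent subcritical moment in `d = 3`, where only lower
bounds (`γ ≥ 1`) are rigorous; it is false in `d = 2` (`γ_{1/2} = 81/72`), so any proof must use `d = 3` structure.
Leans on: `DCT16.perc_sharpness_holds` (finiteness at each `u < p_c`), monotone coupling (`configOfLabels`) for
monotonicity in `u`, Russo / differential inequalities for `u ↦ P_u(|C| ≥ n)` (`russo_formula_holds`).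
[cite: AizenmanNewman1984, main theorem (γ ≥ 1: the only rigorous moment exponent bound near p_c in d = 3)] -/
theorem stub_halfMomentExponent :
    ∃ C a₀ : ℝ, a₀ < 1 ∧ ∀ u : ℝ, 0 ≤ u → u < criticalProb (zdGraph 3) (0 : Site 3) →
      ∑' k : ℕ, ENNReal.ofReal (((k + 1 : ℕ) : ℝ) ^ (-(1 / 2 : ℝ))) *
          bondPercolation (zdGraph 3) (Set.projIcc (0 : ℝ) 1 zero_le_one u) (clusterSizeGe (0 : Site 3) (k + 1))
        ≤ ENNReal.ofReal (C * (criticalProb (zdGraph 3) (0 : Site 3) - u) ^ (-a₀)) := by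
  sorry

/-! ## Name-keyed aliases (hypotheses of the composition, keyed by the registered stub names) -/
namespace Registered

/-- Alias of the statement of `stub_condTwoGhost`. -/
abbrev stub_condTwoGhost : Prop :=
  ∃ C : ℝ, ∀ u : ℝ, 0 ≤ u → u < criticalProb (zdGraph 3) (0 : Site 3) → ∀ k : ℕ,
    ∑ y ∈ (zdGraph 3).neighborFinset (0 : Site 3),
        bondPercolation (zdGraph 3) (Set.projIcc (0 : ℝ) 1 zero_le_one u)
          {ω | ((k + 1 : ℕ) : ℕ∞) ≤ (openCluster ω (0 : Site 3)).encard ∧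
            ((k + 1 : ℕ) : ℕ∞) ≤ (openCluster ω y).encard ∧ ¬ (openGraph ω).Reachable 0 y}
      ≤ ENNReal.ofReal C *
          (ENNReal.ofReal (((k + 1 : ℕ) : ℝ) ^ (-(1 / 2 : ℝ))) *
            bondPercolation (zdGraph 3) (Set.projIcc (0 : ℝ) 1 zero_le_one u)
              (clusterSizeGe (0 : Site 3) (k + 1)))

/-- Alias of the statement of `stub_halfMomentExponent`. -/
abbrev stub_halfMomentExponent : Prop :=
  ∃ C a₀ : ℝ, a₀ < 1 ∧ ∀ u : ℝ, 0 ≤ u → u < criticalProb (zdGraph 3) (0 : Site 3) →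
    ∑' k : ℕ, ENNReal.ofReal (((k + 1 : ℕ) : ℝ) ^ (-(1 / 2 : ℝ))) *
        bondPercolation (zdGraph 3) (Set.projIcc (0 : ℝ) 1 zero_le_one u) (clusterSizeGe (0 : Site 3) (k + 1))
      ≤ ENNReal.ofReal (C * (criticalProb (zdGraph 3) (0 : Site 3) - u) ^ (-a₀))

end Registered

/-- Consistency: each alias IS the registered stub's statement (definitionally). -/
theorem condTwoGhost_holds : Registered.stub_condTwoGhost := stub_condTwoGhost

/-- Consistency: each alias IS the registered stub's statement (definitionally). -/
theorem halfMomentExponent_holds : Registered.stub_halfMomentExponent := stub_halfMomentExponent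

/-! ## Composition: the stubs conclude the crux BY NAME (real proof, no `sorry`) -/

/-- **The skeleton theorem.** Conditional two-ghost (stub A) and the half-moment exponent bound (stub B) give
`MinContactExponent` with constant `max C₁ 0 · C₂` and stub B's exponent `a₀ < 1`:
`m(u) ≤ Σ_k T_{k+1}(u)` (layer cake, landed `Theorems.lintegral_sum_indicator_min_le`)
`≤ Σ_k C₁ (k+1)^{-1/2} P_u(|C(0)| ≥ k+1)` (stub A, termwise) `= C₁ Σ_k …` `≤ C₁ · C₂ (p_c − u)^{-a₀}` (stub B). -/
theorem MinContactExponent_of (hA : Registered.stub_condTwoGhost) (hB : Registered.stub_halfMomentExponent) :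
    Summit.CriticalPhenomena.PercolationContinuityZ3.Theses.PercMinContact.MinContactExponent := by
  obtain ⟨C₁, hA⟩ := hA
  obtain ⟨C₂, a₀, ha₀, hB⟩ := hB
  refine ⟨max C₁ 0 * C₂, a₀, ha₀, fun u hu0 hupc => ?_⟩
  -- Step 1: layer cake in `ℕ∞` + Tonelli (landed with item TwoArmGlue).
  have h1 : minContact u ≤ ∑' k : ℕ, twoArm u k :=
    Summit.CriticalPhenomena.PercolationContinuityZ3.Theorems.lintegral_sum_indicator_min_le
      (zdGraph 3) (Set.projIcc (0 : ℝ) 1 zero_le_one u) (0 : Site 3) ((zdGraph 3).neighborFinset (0 : Site 3))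
  -- Step 2: conditional two-ghost, term by term.
  have h2 : ∑' k : ℕ, twoArm u k ≤ ∑' k : ℕ, ENNReal.ofReal C₁ * halfArm u k :=
    ENNReal.tsum_le_tsum fun k => hA u hu0 hupc k
  -- Step 3: pull the constant out of the series and apply the half-moment bound.
  have h3 : ∑' k : ℕ, ENNReal.ofReal C₁ * halfArm u k ≤
      ENNReal.ofReal (max C₁ 0) * ENNReal.ofReal (C₂ * (criticalProb (zdGraph 3) (0 : Site 3) - u) ^ (-a₀)) := by
    rw [ENNReal.tsum_mul_left]
    exact mul_le_mul' (ENNReal.ofReal_le_ofReal (le_max_left C₁ 0)) (hB u hu0 hupc)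
  -- Step 4: `ofReal` algebra.
  have h4 : ENNReal.ofReal (max C₁ 0) * ENNReal.ofReal (C₂ * (criticalProb (zdGraph 3) (0 : Site 3) - u) ^ (-a₀)) =
      ENNReal.ofReal (max C₁ 0 * C₂ * (criticalProb (zdGraph 3) (0 : Site 3) - u) ^ (-a₀)) := by
    rw [← ENNReal.ofReal_mul (le_max_right C₁ 0), mul_assoc]
  exact h1.trans (h2.trans (h3.trans_eq h4))

/-- Wiring check: the two registered stubs feed `MinContactExponent_of` as stated. -/
example : Summit.CriticalPhenomena.PercolationContinuityZ3.Theses.PercMinContact.MinContactExponent :=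
  MinContactExponent_of condTwoGhost_holds halfMomentExponent_holds

/-! ## Sorry-free dividends: where the stubs sit -/

/-- **Rigorous frontier of stub A, by name**: the UNCONDITIONAL two-ghost inequality (Hutchcroft 2020,
Cor. 1.7) is a theorem of the tree. [cite: Hutchcroft2020Locality, Corollary 1.7] -/
theorem twoGhost_frontier : Hutchcroft2020_twoGhost_corollary :=
  Hutchcroft2020_twoGhost_corollary_holds

/-- **Far-regime input of both stubs, by name**: sharpness of the phase transition on `ℤ^d` (subcritical
exponential decay of the radius) is a theorem of the tree. [cite: AizenmanBarsky1987, Theorem 1 (sharpness; tree proof via Duminil-Copin–Tassion)] -/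
theorem sharpness_frontier : perc_sharpness :=
  DCT16.perc_sharpness_holds

end Summit.CriticalPhenomena.PercolationContinuityZ3.Cruxes.MinContactExponent.Birth

end
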